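import Literature.Probability.LatticeModels.ONModel
import Literature.Probability.LatticeModels.LatticePathChains
import Literature.MathematicalPhysics.QuantumManyBody.CoarseModeRayPOVM
import Mathlib.MeasureTheory.Measure.Haar.Unique
import Mathlib.Analysis.Complex.Isometry
import HarnessLib

/-!
# The classical XY model: `O(2)` sphere vocabulary versus `U(1)` torus vocabulary

The tree's `GarbanSpencer2022_xyLongRangeOrder` is stated for the `N = 2` case of the classical
`O(N)` model of `ONModel` (spins on the unit circle of `ℝ²` with the normalised surface measure
`sphereUniform 2`, Gibbs weight `exp (β ∑_{e ∈ ℰ_Λ} ⟪s_i, s_j⟫)`, free boundary condition,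
`onTwoPoint μ x y = ∫ ⟪s_x, s_y⟫ dμ`), while the proof (Garban–Spencer, arXiv:2109.01617, (1.1):
`e^{β ∑_{i∼j} cos(θ_i − θ_j)} ∏ dθ_i`) is written on the torus `U(1)^Λ` with its Haar probability
measure (`DisorderedXYModel`, bond system `latticeBonds Λ` of `LatticePathChains`).  This file
PROVES that the two renderings agree:

  `onTwoPoint (onMeasure (N := 2) (zdGraph d) Λ β free) x y = ⟨cos(θ_x − θ_y)⟩_{1,β}`
  (`onTwoPoint_onMeasure_two_eq_expect`).

Ingredients: the isometry `ℝ² ≅ ℂ` (`Complex.orthonormalBasisOneI`) restricts to a bijection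
`SphereSpin 2 → Circle` (`toCircle`) with `⟪v, w⟫ = Re (conj (toCircle v) · toCircle w)`; the image
of `sphereUniform 2` is invariant under multiplication (rotations of `ℝ²` preserve
`Measure.toSphere volume`: the tree's `BoseGas.map_unitSphereMap_toSphere` from
`QuantumManyBody/CoarseModeRayPOVM`, reused here) hence equals the normalised Haar measure of `U(1)`
by uniqueness (`map_toCircle_sphereUniform`); the product map transports the reference measure of
`ONModel` to `torusHaar Λ` (`measurePreserving_pi`); finally `Measure.tilted`, `Measure.map` along
the gluing and the Friedli–Velenik edge sum over `edgesIn` are unfolded.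

## References

* C. Garban, T. Spencer, arXiv:2109.01617, (1.1)–(1.2). [GarbanSpencer2022]
* S. Friedli, Y. Velenik, *Statistical Mechanics of Lattice Systems*, §9.1 (the `O(N)` / XY
  model). [FriedliVelenik2017]
-/

noncomputable section

open MeasureTheory Finset TopologicalSpace Metric Set
open scoped BigOperators ComplexConjugate RealInnerProductSpace ENNReal Pointwise

namespace Literature.Probability.LatticeModels

open Literature.MathematicalPhysics.QuantumManyBody.BoseGas (unitSphereMap coe_unitSphereMap
  continuous_unitSphereMap map_unitSphereMap_toSphere)

/-! ### `ℝ² ≅ ℂ` and the circle map -/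

/-- The isometry `ℝ² ≃ ℂ`, `v ↦ v₀ + v₁ i` (inverse of `Complex.orthonormalBasisOneI.repr`).
[folklore] -/
def e2c : EuclideanSpace ℝ (Fin 2) ≃ₗᵢ[ℝ] ℂ := Complex.orthonormalBasisOneI.repr.symm

/-- The real inner product of `ℝ²` in complex form: `⟪v, w⟫ = Re (conj (e2c v) · e2c w)`.
[folklore] -/
theorem inner_eq_re_conj_mul (v w : EuclideanSpace ℝ (Fin 2)) :
    ⟪v, w⟫ = (conj (e2c v) * e2c w).re := by
  rw [← e2c.inner_map_map v w, Complex.inner, mul_comm]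

/-- **The circle map** `SphereSpin 2 → Circle`, `v ↦ v₀ + v₁ i`. [folklore] -/
def toCircle (v : SphereSpin 2) : Circle :=
  ⟨e2c v, by
    rw [Submonoid.unitSphere, Submonoid.mem_mk, Subsemigroup.mem_mk, mem_sphere_zero_iff_norm,
      LinearIsometryEquiv.norm_map]
    exact mem_sphere_zero_iff_norm.1 v.2⟩

/-- `toCircle v` as a complex number is `e2c v`. [folklore] -/
@[simp] theorem coe_toCircle (v : SphereSpin 2) : ((toCircle v : Circle) : ℂ) = e2c v := rfl

/-- **The `O(2)` bond observable in `U(1)` form**: `⟪v, w⟫ = Re (conj (toCircle v) · toCircle w)`.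
[folklore] -/
theorem inner_sphere_eq (v w : SphereSpin 2) :
    ⟪(v : EuclideanSpace ℝ (Fin 2)), (w : EuclideanSpace ℝ (Fin 2))⟫ =
      (conj ((toCircle v : Circle) : ℂ) * (toCircle w : ℂ)).re :=
  inner_eq_re_conj_mul _ _

/-- `toCircle` is continuous. [folklore] -/
theorem continuous_toCircle : Continuous toCircle :=
  Continuous.subtype_mk (e2c.continuous.comp continuous_subtype_val) _

/-- `toCircle` is a bijection (its inverse is the restriction of `e2c.symm`). [folklore] -/
theorem toCircle_bijective : Function.Bijective toCircle := by
  constructor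
  · intro v w h
    have := congrArg (fun z : Circle => (z : ℂ)) h
    simp only [coe_toCircle] at this
    exact Subtype.ext (e2c.injective this)
  · intro z
    refine ⟨⟨e2c.symm z, ?_⟩, ?_⟩
    · rw [mem_sphere_zero_iff_norm, LinearIsometryEquiv.norm_map, Circle.norm_coe]
    · apply Subtype.ext
      simp [toCircle]

/-! ### Rotations of `ℝ²` and multiplication on the circle -/

/-- The rotation of `ℝ²` by the unit complex number `g` (conjugate of `rotation g` by `e2c`).
[folklore] -/
def rot (g : Circle) : EuclideanSpace ℝ (Fin 2) ≃ₗᵢ[ℝ] EuclideanSpace ℝ (Fin 2) :=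
  e2c.trans ((rotation g).trans e2c.symm)

/-- **Rotating then reading off the complex number is multiplying**:
`toCircle (rot g · v) = g · toCircle v` (with the tree's `unitSphereMap`). [folklore] -/
theorem toCircle_unitSphereMap_rot (g : Circle) (v : SphereSpin 2) :
    toCircle (unitSphereMap (rot g) v) = g * toCircle v := by
  apply Subtype.ext
  simp [toCircle, rot, rotation_apply]

/-- The uniform probability on the circle of `ℝ²` is rotation invariant (from the tree's
`map_unitSphereMap_toSphere`). [folklore] -/
theorem map_unitSphereMap_sphereUniform (f : EuclideanSpace ℝ (Fin 2) ≃ₗᵢ[ℝ] EuclideanSpace ℝ (Fin 2)) :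
    (sphereUniform 2).map (unitSphereMap f) = sphereUniform 2 := by
  rw [sphereUniform, Measure.map_smul, map_unitSphereMap_toSphere]

/-! ### The image of the uniform measure is the Haar measure of `U(1)` -/

section Haar

variable [MeasurableSpace Circle] [BorelSpace Circle]

/-- `toCircle` is measurable (Borel σ-algebra on `Circle`). [folklore] -/
theorem measurable_toCircle : Measurable toCircle := continuous_toCircle.measurable

/-- **`toCircle` carries the uniform measure of the circle of `ℝ²` to the normalised Haar
measure of `U(1)`** (left invariance by rotation invariance, then uniqueness of Haar measure).
[folklore] -/
theorem map_toCircle_sphereUniform :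
    (sphereUniform 2).map toCircle = Measure.haarMeasure (⊤ : PositiveCompacts Circle) := by
  set ν := (sphereUniform 2).map toCircle with hν
  haveI : IsProbabilityMeasure ν := Measure.isProbabilityMeasure_map measurable_toCircle.aemeasurable
  haveI : ν.IsMulLeftInvariant := by
    refine ⟨fun g => ?_⟩
    rw [hν, Measure.map_map (measurable_const_mul g) measurable_toCircle]
    have e : (fun z : Circle => g * z) ∘ toCircle = toCircle ∘ unitSphereMap (rot g) := by
      funext v; simp [toCircle_unitSphereMap_rot]
    rw [e, ← Measure.map_map measurable_toCircle (continuous_unitSphereMap _).measurable,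
      map_unitSphereMap_sphereUniform]
  have h := Measure.haarMeasure_unique ν (⊤ : PositiveCompacts Circle)
  rw [h, PositiveCompacts.coe_top, measure_univ, one_smul]

/-- `toCircle` is measure preserving from `sphereUniform 2` to the Haar probability of `U(1)`.
[folklore] -/
theorem measurePreserving_toCircle :
    MeasurePreserving toCircle (sphereUniform 2) (Measure.haarMeasure (⊤ : PositiveCompacts Circle)) :=
  ⟨measurable_toCircle, map_toCircle_sphereUniform⟩

/-- **The product circle map transports the `O(2)` reference measure to the torus Haar measure.**
[folklore] -/
theorem measurePreserving_pi_toCircle (α : Type*) [Fintype α] :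
    MeasurePreserving (fun (ζ : α → SphereSpin 2) (a : α) => toCircle (ζ a))
      (Measure.pi fun _ : α => sphereUniform 2) (torusHaar α) :=
  measurePreserving_pi (fun _ : α => sphereUniform 2)
    (fun _ : α => Measure.haarMeasure (⊤ : PositiveCompacts Circle)) fun _ => measurePreserving_toCircle

end Haar

/-! ### The two-point function of the `O(2)` model is the XY correlation on the torus -/

section Bridge

variable {d : ℕ} [MeasurableSpace Circle] [BorelSpace Circle]

omit [MeasurableSpace Circle] [BorelSpace Circle] in
/-- Pulled back along the free gluing and pushed along the circle map, the `O(2)` Boltzmann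
exponent is the XY energy of the bond system of `Λ`:
`−β H_Λ^{free}(glue ζ) = β ∑_a Re (conj θ_{src a} θ_{tgt a})`, `θ = toCircle ∘ ζ`. [folklore] -/
theorem neg_mul_onHamiltonian_onGlue (Λ : Finset (Site d)) (β : ℝ) (ζ : ↥Λ → SphereSpin 2) :
    -β * onHamiltonian (zdGraph d) Λ ONBoundary.free (onGlue Λ ζ ONBoundary.free) =
      β * (latticeBonds Λ).energy 1 (fun a => toCircle (ζ a)) := by
  rw [onHamiltonian, ONBoundary.interactionEdges_free, mul_neg, neg_mul, neg_neg]
  congr 1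
  rw [BondSystem.energy_one, ← Finset.sum_coe_sort (edgesIn (zdGraph d) Λ)]
  refine Finset.sum_congr rfl fun a _ => ?_
  have hsrc := (mem_edgesIn_iff.1 a.2).2 _ (Sym2.out_fst_mem a.1)
  have htgt := (mem_edgesIn_iff.1 a.2).2 _ (Sym2.out_snd_mem a.1)
  conv_lhs => rw [← Sym2.mk_out (a : Sym2 (Site d))]
  rw [onBond_mk, onGlue, glueWith_apply_mem _ _ _ hsrc, glueWith_apply_mem _ _ _ htgt, inner_sphere_eq]
  rfl

omit [MeasurableSpace Circle] [BorelSpace Circle] in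
/-- The `O(2)` two-point observable in `U(1)` form: `⟪s_x, s_y⟫ = cos(θ_x − θ_y)`. [folklore] -/
theorem inner_onGlue_eq_cosDiff (Λ : Finset (Site d)) {x y : Site d} (hx : x ∈ Λ) (hy : y ∈ Λ)
    (ζ : ↥Λ → SphereSpin 2) :
    ⟪((onGlue Λ ζ ONBoundary.free x : SphereSpin 2) : EuclideanSpace ℝ (Fin 2)),
      ((onGlue Λ ζ ONBoundary.free y : SphereSpin 2) : EuclideanSpace ℝ (Fin 2))⟫ =
      cosDiff (⟨x, hx⟩ : ↥Λ) ⟨y, hy⟩ (fun a => toCircle (ζ a)) := by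
  rw [onGlue, glueWith_apply_mem _ _ _ hx, glueWith_apply_mem _ _ _ hy, inner_sphere_eq, cosDiff]

/-- **Bridge theorem.** The two-point function of the classical `O(2)` model of `ONModel`
(`N = 2`, free boundary condition, nearest-neighbour graph of `ℤ^d`) is the spin–spin correlation
`⟨cos(θ_x − θ_y)⟩` of the XY model (1.1) of Garban–Spencer on the torus `U(1)^Λ`, for the bond
system `latticeBonds Λ` without phases. [cite: GarbanSpencer2022, (1.1)–(1.2)] -/
theorem onTwoPoint_onMeasure_two_eq_expect (Λ : Finset (Site d)) (β : ℝ) {x y : Site d}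
    (hx : x ∈ Λ) (hy : y ∈ Λ) :
    onTwoPoint (onMeasure (N := 2) (zdGraph d) Λ β ONBoundary.free) x y =
      (latticeBonds Λ).expect β 1 (cosDiff ⟨x, hx⟩ ⟨y, hy⟩) := by
  set G := latticeBonds Λ with hG
  set π : Measure (↥Λ → SphereSpin 2) := onReference 2 Λ with hπ
  set gl : (↥Λ → SphereSpin 2) → ONConfig (Site d) 2 := fun ζ => onGlue Λ ζ ONBoundary.free with hgl
  set Φ : (↥Λ → SphereSpin 2) → (↥Λ → Circle) := fun ζ a => toCircle (ζ a) with hΦ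
  have hΦmp : MeasurePreserving Φ π (torusHaar ↥Λ) := measurePreserving_pi_toCircle ↥Λ
  have hglm : Measurable gl := measurable_onGlue Λ ONBoundary.free
  -- transport of integrals along `Φ`
  have transport : ∀ {g : (↥Λ → Circle) → ℝ}, Continuous g → ∫ ζ, g (Φ ζ) ∂π = ∫ θ, g θ ∂torusHaar ↥Λ := by
    intro g hg
    rw [← hΦmp.map_eq, integral_map hΦmp.measurable.aemeasurable hg.aestronglyMeasurable]
  -- the Boltzmann factor and the observable along `gl`
  set H : ONConfig (Site d) 2 → ℝ := fun s => -β * onHamiltonian (zdGraph d) Λ ONBoundary.free s with hH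
  have hHm : Measurable H := (measurable_onHamiltonian (zdGraph d) Λ ONBoundary.free).const_mul _
  have hw : ∀ ζ, Real.exp (H (gl ζ)) = G.weight β 1 (Φ ζ) := fun ζ => by
    rw [hH, hgl, BondSystem.weight]; dsimp only; rw [neg_mul_onHamiltonian_onGlue]
  have hobs : ∀ ζ, ⟪((gl ζ x : SphereSpin 2) : EuclideanSpace ℝ (Fin 2)),
      ((gl ζ y : SphereSpin 2) : EuclideanSpace ℝ (Fin 2))⟫ = cosDiff (⟨x, hx⟩ : ↥Λ) ⟨y, hy⟩ (Φ ζ) :=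
    fun ζ => inner_onGlue_eq_cosDiff Λ hx hy ζ
  have hinm : Measurable fun s : ONConfig (Site d) 2 =>
      ⟪((s x : SphereSpin 2) : EuclideanSpace ℝ (Fin 2)), ((s y : SphereSpin 2) : EuclideanSpace ℝ (Fin 2))⟫ :=
    ((measurable_pi_apply x).subtype_val).inner (measurable_pi_apply y).subtype_val
  -- unfold the Gibbs measure
  unfold onTwoPoint onMeasure
  rw [integral_tilted]
  simp_rw [smul_eq_mul]
  -- denominator
  have hZ : ∫ s, Real.exp (H s) ∂(π.map gl) = G.partitionFn β 1 := by
    rw [integral_map (f := fun s => Real.exp (H s)) hglm.aemeasurable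
      (by exact (Real.measurable_exp.comp hHm).aestronglyMeasurable)]
    simp_rw [hw]
    exact transport (G.continuous_weight β 1)
  -- numerator
  have hN : ∫ s, Real.exp (H s) / (∫ s, Real.exp (H s) ∂(π.map gl)) *
      ⟪((s x : SphereSpin 2) : EuclideanSpace ℝ (Fin 2)), ((s y : SphereSpin 2) : EuclideanSpace ℝ (Fin 2))⟫ ∂(π.map gl) =
      (∫ θ, cosDiff (⟨x, hx⟩ : ↥Λ) ⟨y, hy⟩ θ * G.weight β 1 θ ∂torusHaar ↥Λ) / G.partitionFn β 1 := by
    rw [hZ]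
    have e : ∀ s : ONConfig (Site d) 2, Real.exp (H s) / G.partitionFn β 1 *
        ⟪((s x : SphereSpin 2) : EuclideanSpace ℝ (Fin 2)), ((s y : SphereSpin 2) : EuclideanSpace ℝ (Fin 2))⟫ =
        (⟪((s x : SphereSpin 2) : EuclideanSpace ℝ (Fin 2)), ((s y : SphereSpin 2) : EuclideanSpace ℝ (Fin 2))⟫ *
          Real.exp (H s)) / G.partitionFn β 1 := fun s => by ring
    simp_rw [e]
    rw [integral_div, integral_map (f := fun s : ONConfig (Site d) 2 =>
      ⟪((s x : SphereSpin 2) : EuclideanSpace ℝ (Fin 2)), ((s y : SphereSpin 2) : EuclideanSpace ℝ (Fin 2))⟫ *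
        Real.exp (H s)) hglm.aemeasurable
      (by exact (hinm.mul (Real.measurable_exp.comp hHm)).aestronglyMeasurable)]
    congr 1
    simp_rw [hobs, hw]
    exact transport ((continuous_cosDiff _ _).mul (G.continuous_weight β 1))
  rw [hH] at hN
  simp only at hN
  rw [hN, BondSystem.expect]

end Bridge

end Literature.Probability.LatticeModels
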